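import Summits.HodgeConjecture.HodgeConjecture.Theses.BoundaryReadout
import Summits.HodgeConjecture.HodgeConjecture.Theses.QbarEnvelope
import Summits.HodgeConjecture.HodgeConjecture.Theses.PeriodDeficiency
import Summits.HodgeConjecture.HodgeConjecture.Theses.MotivatedLefschetzSplit
import Summits.HodgeConjecture.HodgeConjecture.Theorems.QbarEnvelopeEnvelopeStubNumberFieldModel
import Summits.HodgeConjecture.HodgeConjecture.Theorems.AnchorTransportAnchorExistenceStubDefinableOfRigid
import Summits.HodgeConjecture.HodgeConjecture.Theorems.PeriodDeficiencyHodgeConjectureQbarStubLefschetzRange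
import Summits.HodgeConjecture.HodgeConjecture.Theorems.PeriodDeficiencyHodgeConjectureQbarOfMotivatedLefschetzSplit
import Literature.AlgebraicGeometry.HodgeTheory.AlgebraicCyclesDefinedOverQbarSpread
import Literature.AlgebraicGeometry.HodgeTheory.IsoTransport
import Literature.AlgebraicGeometry.HodgeTheory.MotivatedClassesProofs
import HarnessLib

/-!
# Route BoundaryReadout — crux `HCOverNumberFields` (stmt-HodgeConjecture-1070): the transfer to the
# `ℚ̄`-typed crux `HodgeConjectureQbar` (stmt-HodgeConjecture-11596), proved, and what follows from it

The shared crux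

  `HCOverNumberFields := ∀ n X, IsSmoothProjective n X → (∃ K [NumberField K] (σ : K →+* ℂ) X₀,
     X ≅ X₀ ×_{K,σ} ℂ) → HodgeConjectureFor n X`

(`BoundaryReadout.HCOverNumberFields` = `QbarEnvelope.HCOverNumberFields`, one ledger item, the two
bodies agree by `Iff.rfl`) is the Hodge conjecture for smooth projective complex varieties definable
over a number field — an OPEN PROBLEM (it contains the algebraicity of Weil classes on CM abelian
varieties of Weil type of dimension `≥ 6`). This file does not claim it. It lands, as helpers attached
to the item, the theorems that pin its exact position in the hub:

1. **The transfer** `hcOverNumberFields_iff_hodgeConjectureQbar`: the crux is EQUIVALENT to the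
   `ℚ̄`-typed crux `PeriodDeficiency.HodgeConjectureQbar` (stmt-HodgeConjecture-11596:
   `∀ (σ : ℚ̄ →+* ℂ) n X₀, IsSmoothProjective n (X₀ ×_{ℚ̄,σ} ℂ) → HodgeConjectureFor n (X₀ ×_{ℚ̄,σ} ℂ)`).
   `ℚ̄ ⇒ number field`: an embedding `σ : K →+* ℂ` of a number field factors as `τ ∘ i` through `ℚ̄`
   (`exists_ringHom_comp_eq_of_numberField`, Mathlib `IsAlgClosed.lift` twice), base change is
   transitive (`QbarFibreAnchors.iso_baseChangeHom_comp_of_rigid`), and `HodgeConjectureFor`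
   transports along isomorphisms (`IsoTransport`). `number field ⇒ ℚ̄`: `X₀ ×_{ℚ̄,τ} ℂ` smooth
   projective ⟹ `X₀` smooth projective (`isSmoothProjective_of_baseChangeHom`, descent) ⟹
   `X₀ ≅ X₁ ⊗_{K,ι} ℚ̄` for a number field `K` (EGA IV₃ 8.8.2 (ii), the landed
   `Theorems.stub_numberFieldModel`) ⟹ `X₀ ×_τ ℂ ≅ X₁ ⊗_{K,τ∘ι} ℂ`. So stmt-1070 and stmt-11596 are
   ONE open problem: a proof of either closes both (`hcOverNumberFields_of_hodgeConjectureQbar`,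
   `hodgeConjectureQbar_of_hcOverNumberFields`).
2. **The André bridge** `hcOverNumberFields_of_motivatedLefschetzSplit`: the crux follows from the
   three items of route `MotivatedLefschetzSplit` — `HodgeClassesMotivated` (stmt-17488),
   `LefschetzStandardB` (stmt-17489), `DiagonalPullbackAlgebraic` (stmt-17490) — through the landed
   `periodDeficiency_hodgeConjectureQbar_of_motivatedLefschetzSplit` and the transfer.
3. **Unconditional special cases**: the cycle clause of the crux in the Lefschetz range
   `p ≤ 1 ∨ n ≤ p + 1` on every smooth projective complex variety (`hcOverNumberFields_lefschetzRange`),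
   and THE CRUX FOR `n ≤ 3` outright (`hcOverNumberFields_of_dim_le_three`); its open content starts at
   arithmetic fourfolds, `p = 2`.

Adapted from the crux workfile `Cruxes/HCOverNumberFields/Lines/andre_transfer.lean`
(planner-cstrat-stmt-HodgeConjecture-1070-s1-0, 2026-08-17), whose sorry-free part this is; the two
open stubs of that line (André's cut: Hodge ⇒ motivated in the deep middle range, motivated ⇒
algebraic in the middle range, on `ℚ̄`-varieties) are NOT restated here — they are the items of
route `MotivatedLefschetzSplit` specialised to `ℚ̄`, consumed in (2) by name.

## References

* [Voisin2007HodgeLoci] C. Voisin, Hodge loci and absolute Hodge classes, Compositio Math. 143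
  (2007), Rem. 1.4 (number field vs. `ℚ̄`).
* [EGAIV3] A. Grothendieck, ÉGA IV₃, Thm. 8.8.2 (ii) (models of finite presentation over a limit).
* [Andre1996Motifs] Y. André, Pour une théorie inconditionnelle des motifs, Publ. Math. IHÉS 83
  (1996), §0.4, §2.1.
* [VoisinHodgeI2002] C. Voisin, Hodge Theory and Complex Algebraic Geometry I, Thm. 6.25, Thm. 11.30.
-/

-- every declaration of this problem lives in `Summit.HodgeConjecture.HodgeConjecture.…` (summit = sub-problem)
set_option linter.dupNamespace false

noncomputable section

namespace Summit.HodgeConjecture.HodgeConjecture.Theorems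

open CategoryTheory AlgebraicGeometry
open Literature.AlgebraicGeometry.Motives Literature.AlgebraicGeometry.HodgeTheory
open Summit.HodgeConjecture.HodgeConjecture.Theses
open Summit.HodgeConjecture.HodgeConjecture.Theorems.QbarFibreAnchors (iso_baseChangeHom_comp_of_rigid)

/-! ### 1. The transfer `HCOverNumberFields ↔ HodgeConjectureQbar` -/

/-- **Every embedding of a number field into `ℂ` factors through `ℚ̄`.** For a number field `K` and
`σ : K →+* ℂ` there are `i : K →+* ℚ̄` and `τ : ℚ̄ →+* ℂ` with `τ ∘ i = σ`: `K/ℚ` is algebraic, so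
`i` exists (`IsAlgClosed.lift`); `ℚ̄` is algebraic over `i(K)`, so the `K`-algebra map `τ` into the
algebraically closed `K`-algebra `(ℂ, σ)` exists (`IsAlgClosed.lift` again). [folklore] -/
theorem exists_ringHom_comp_eq_of_numberField (K : Type) [Field K] [NumberField K] (σ : K →+* ℂ) :
    ∃ (i : K →+* AlgebraicClosure ℚ) (τ : AlgebraicClosure ℚ →+* ℂ), τ.comp i = σ := by
  classical
  haveI : Algebra.IsAlgebraic ℚ K := Algebra.IsAlgebraic.of_finite ℚ K
  let i : K →ₐ[ℚ] AlgebraicClosure ℚ := IsAlgClosed.lift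
  letI : Algebra K (AlgebraicClosure ℚ) := i.toRingHom.toAlgebra
  letI : Algebra K ℂ := σ.toAlgebra
  haveI : IsScalarTower ℚ K (AlgebraicClosure ℚ) :=
    IsScalarTower.of_algebraMap_eq fun x ↦ by
      show algebraMap ℚ (AlgebraicClosure ℚ) x = i.toRingHom (algebraMap ℚ K x)
      simp
  haveI : Algebra.IsAlgebraic ℚ (AlgebraicClosure ℚ) := AlgebraicClosure.isAlgebraic ℚ
  haveI : Algebra.IsAlgebraic K (AlgebraicClosure ℚ) := Algebra.IsAlgebraic.tower_top (K := ℚ) K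
  let τ : AlgebraicClosure ℚ →ₐ[K] ℂ := IsAlgClosed.lift
  exact ⟨i.toRingHom, τ.toRingHom, RingHom.ext fun x ↦ τ.commutes x⟩

/-- **`HodgeConjectureFor` transports along isomorphisms of `ℂ`-schemes** (Hodge models, rational
`(p,p)` classes and algebraic classes all do: `IsoTransport.nonempty_hodgeModel_iff_of_iso`,
`forall_hodgeClass_mem_algebraicClasses_iff_of_iso`). [cite: SerreGAGA1956, §2] -/
theorem hodgeConjectureFor_transport_of_iso {n : ℕ} {X X' : SchemeOver ℂ} (e : X' ≅ X)
    (h : HodgeConjectureFor n X) : HodgeConjectureFor n X' :=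
  ⟨(nonempty_hodgeModel_iff_of_iso e).2 h.1,
    fun p ↦ (forall_hodgeClass_mem_algebraicClasses_iff_of_iso (n := n) e p).2 (h.2 p)⟩

/-- **`ℚ̄`-form ⇒ number-field form.** If the Hodge conjecture holds for every smooth projective
`X₀ ×_{ℚ̄,τ} ℂ` (`PeriodDeficiency.HodgeConjectureQbar`, stmt-HodgeConjecture-11596), it holds for
every smooth projective complex variety definable over a number field
(`BoundaryReadout.HCOverNumberFields`, stmt-HodgeConjecture-1070):
`X ≅ X₀ ⊗_{K,σ} ℂ = X₀ ⊗_{K,τ∘i} ℂ ≅ (X₀ ⊗_{K,i} ℚ̄) ⊗_{ℚ̄,τ} ℂ`. A CONDITIONAL result (the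
hypothesis is an open route item). [cite: Voisin2007HodgeLoci, Rem. 1.4] -/
theorem hcOverNumberFields_of_hodgeConjectureQbar (h : PeriodDeficiency.HodgeConjectureQbar) :
    BoundaryReadout.HCOverNumberFields := by
  unfold BoundaryReadout.HCOverNumberFields
  rintro n X hX ⟨K, _, _, σ, X₀, ⟨e⟩⟩
  obtain ⟨i, τ, hτ⟩ := exists_ringHom_comp_eq_of_numberField K σ
  subst hτ
  obtain ⟨e₂⟩ := iso_baseChangeHom_comp_of_rigid i τ X₀
  have e' : X ≅ (baseChangeHom τ).obj ((baseChangeHom i).obj X₀) := e ≪≫ e₂.symm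
  exact hodgeConjectureFor_transport_of_iso e' (h τ (hX.of_iso e'))

/-- **Number-field form ⇒ `ℚ̄`-form.** If the Hodge conjecture holds for every smooth projective
complex variety definable over a number field, it holds for every smooth projective `X₀ ×_{ℚ̄,τ} ℂ`:
`X₀` is smooth projective over `ℚ̄` (descent, `isSmoothProjective_of_baseChangeHom`), hence
`X₀ ≅ X₁ ⊗_{K,ι} ℚ̄` for a number field `K` (EGA IV₃ 8.8.2 (ii): the landed
`Theorems.stub_numberFieldModel`), and `X₀ ×_τ ℂ ≅ X₁ ⊗_{K,τ∘ι} ℂ`. A CONDITIONAL result.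
[cite: EGAIV3, Thm. 8.8.2 (ii)] [cite: GortzWedhorn2020, Prop. 10.75] -/
theorem hodgeConjectureQbar_of_hcOverNumberFields (h : BoundaryReadout.HCOverNumberFields) :
    PeriodDeficiency.HodgeConjectureQbar := by
  unfold PeriodDeficiency.HodgeConjectureQbar
  intro τ n X₀ hX
  have hX₀ : IsSmoothProjective n X₀ := isSmoothProjective_of_baseChangeHom τ X₀ hX
  obtain ⟨K, _, _, ι, X₁, ⟨e₁⟩⟩ := stub_numberFieldModel X₀ hX₀
  obtain ⟨e₂⟩ := iso_baseChangeHom_comp_of_rigid ι τ X₁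
  exact h hX ⟨K, inferInstance, inferInstance, τ.comp ι, X₁, ⟨(baseChangeHom τ).mapIso e₁ ≪≫ e₂⟩⟩

/-- **THE TRANSFER: stmt-HodgeConjecture-1070 ⟺ stmt-HodgeConjecture-11596.**
`BoundaryReadout.HCOverNumberFields` (= `QbarEnvelope.HCOverNumberFields`) is equivalent to
`PeriodDeficiency.HodgeConjectureQbar` (= the antecedent of `PeriodsPolice.QbarDescent`): the two
cruxes are one open problem, and a proof of either closes both items.
[cite: Voisin2007HodgeLoci, Rem. 1.4] [cite: EGAIV3, Thm. 8.8.2 (ii)] -/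
theorem hcOverNumberFields_iff_hodgeConjectureQbar :
    BoundaryReadout.HCOverNumberFields ↔ PeriodDeficiency.HodgeConjectureQbar :=
  ⟨hodgeConjectureQbar_of_hcOverNumberFields, hcOverNumberFields_of_hodgeConjectureQbar⟩

/-- The two route spellings of the shared item stmt-HodgeConjecture-1070 are one statement
(`Iff.rfl`). [folklore] -/
theorem qbarEnvelope_hcOverNumberFields_iff :
    QbarEnvelope.HCOverNumberFields ↔ BoundaryReadout.HCOverNumberFields :=
  Iff.rfl

/-! ### 2. The André bridge: the crux from the items of route `MotivatedLefschetzSplit` -/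

/-- **`HCOverNumberFields` from `HM`, `B` and `Δ`** (conditional, cross-route bridge): the crux
follows from the `MotivatedLefschetzSplit` items `HodgeClassesMotivated` (stmt-HodgeConjecture-17488:
rational `(p,p)` classes with `2 ≤ p`, `2p ≤ dim X` are motivated, André 1996 §0.4),
`LefschetzStandardB` (stmt-HodgeConjecture-17489: Grothendieck's standard conjecture of Lefschetz
type in André's `*_L`-form) and `DiagonalPullbackAlgebraic` (stmt-HodgeConjecture-17490, Voisin II
Prop. 9.21 (i)), by the landed `ℚ̄`-bridge
`periodDeficiency_hodgeConjectureQbar_of_motivatedLefschetzSplit` and the transfer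
`hcOverNumberFields_of_hodgeConjectureQbar`. [cite: Andre1996Motifs, §0.4 and §2.1] -/
theorem hcOverNumberFields_of_motivatedLefschetzSplit
    (hHM : MotivatedLefschetzSplit.HodgeClassesMotivated)
    (hB : MotivatedLefschetzSplit.LefschetzStandardB)
    (hΔ : MotivatedLefschetzSplit.DiagonalPullbackAlgebraic) :
    BoundaryReadout.HCOverNumberFields :=
  hcOverNumberFields_of_hodgeConjectureQbar
    (periodDeficiency_hodgeConjectureQbar_of_motivatedLefschetzSplit hHM hB hΔ)

/-! ### 3. Unconditional special cases of the crux -/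

/-- **The crux's cycle clause holds in the Lefschetz range on every smooth projective complex
variety** (`p ≤ 1 ∨ n ≤ p + 1`: `p = 0`, Lefschetz `(1,1)`, hard Lefschetz for `n − p ≤ 1`, and
`p > n`), by the tree theorem `mem_algebraicClasses_of_lefschetzRange` fed with the discharged facts
`lefschetzOneOne_rational_holds` and `nonempty_hardLefschetzNFold_holds`; no definability hypothesis
is needed. [cite: VoisinHodgeI2002, Thm. 6.25 and Thm. 11.30] -/
theorem hcOverNumberFields_lefschetzRange :
    ∀ ⦃n : ℕ⦄ ⦃X : SchemeOver ℂ⦄, IsSmoothProjective n X →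
      ∀ (p : ℕ), (p ≤ 1 ∨ n ≤ p + 1) →
        ∀ (c : complexBetti X (2 * p)), IsRationalClass c → IsOfHodgeType n X (2 * p) p p c →
          c ∈ algebraicClasses X p :=
  fun n X hX _ hp c hc hpp ↦
    mem_algebraicClasses_of_lefschetzRange lefschetzOneOne_rational_holds
      (nonempty_hardLefschetzNFold_holds n X) hX hp c hc hpp

/-- **THE CRUX FOR `n ≤ 3`, unconditionally**: for a smooth projective complex variety of dimension
at most `3` (definable over a number field or not) every codimension is in the Lefschetz range, and
Hodge models exist (`QbarEnvelope.HodgeModels_holds`). The open content of `HCOverNumberFields`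
therefore starts at arithmetic FOURFOLDS, `p = 2`. [cite: VoisinHodgeI2002, Thm. 11.30]
[cite: Murre1977, Rem. 1] -/
theorem hcOverNumberFields_of_dim_le_three :
    ∀ ⦃n : ℕ⦄ ⦃X : SchemeOver ℂ⦄, n ≤ 3 → IsSmoothProjective n X →
      (∃ (K : Type) (_ : Field K) (_ : NumberField K) (σ : K →+* ℂ) (X₀ : SchemeOver K),
        Nonempty (X ≅ (baseChangeHom σ).obj X₀)) →
      HodgeConjectureFor n X :=
  fun n X hn hX _ ↦
    ⟨(QbarEnvelope.HodgeModels_holds n X).nonempty hX,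
      fun p c hc hpp ↦ hcOverNumberFields_lefschetzRange hX p (by omega) c hc hpp⟩

/-- **What the crux gives on `ℚ̄`-models, unfolded**: "rational `(p,p)` ⇒ algebraic" on every smooth
projective `X₀ ×_{ℚ̄,σ} ℂ` (through `hodgeConjectureQbar_of_hcOverNumberFields`). Recorded so that
consumers typed over `ℚ̄` (routes `PeriodsPolice`, `PeriodDeficiency`, `FiniteTreeOfFlavours`) can
cite the number-field crux directly. [cite: Voisin2007HodgeLoci, Rem. 1.4] -/
theorem hodgeClassesAlgebraicQbar_of_hcOverNumberFields (h : BoundaryReadout.HCOverNumberFields) :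
    ∀ (σ : AlgebraicClosure ℚ →+* ℂ) ⦃n : ℕ⦄ ⦃X₀ : SchemeOver (AlgebraicClosure ℚ)⦄,
      IsSmoothProjective n ((baseChangeHom σ).obj X₀) →
        ∀ (p : ℕ) (c : complexBetti ((baseChangeHom σ).obj X₀) (2 * p)),
          IsRationalClass c → IsOfHodgeType n ((baseChangeHom σ).obj X₀) (2 * p) p p c →
            c ∈ algebraicClasses ((baseChangeHom σ).obj X₀) p :=
  fun σ _ _ hX p c hc hpp ↦ ((hodgeConjectureQbar_of_hcOverNumberFields h) σ hX).2 p c hc hpp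

end Summit.HodgeConjecture.HodgeConjecture.Theorems

end
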